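import Literature.MeasureTheory.Group.OrbitTubeMeasure
import Mathlib.MeasureTheory.Measure.Prod
import Mathlib.MeasureTheory.Measure.WithDensity
import HarnessLib

/-!
# TENSORING a local product chart with a parametrised family of FULL charts
# (the Fubini lift of the anchor core to the whole tree-gauged ring space — layer (B2) of the DIRECT Laplace road to
# ⟨stmt-QuantumFields-24204⟩ `VirialFluxGap.SharpTwistedLaplace`)

Helper module (free-hands work of width seat ym-line-sfw-p2-w3 g57, cell ym-idea-1; `--supports 24204`).  Abstract measure theory, no
lattice content.  SETTING: a «group window» `Φ ⊆ Z` (measure `κ`), an ANCHOR slice window `B₁ ⊆ Y₁` (measure `ρ₁`) with window map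
`Θ₁ : Z × Y₁ → X₁` satisfying a LOCAL PRODUCT CHART identity `μ₁|_{Θ₁(Φ×B₁)} = Θ₁_*(J₁ · (κ ⊗ ρ₁)|_{Φ×B₁})` (the anchor core,
✓`AnchorSlice.haar_prod_restrict_image_anchorMap`), and a `z`-PARAMETRISED family of FULL charts of a second factor `X₂`:
`c : Z × Y₂ → X₂` with `(c z)_*(J₂ · ρ₂|_{B₂}) = μ₂` and `c z (B₂) = X₂` for every `z ∈ Φ` (the conjugated left exponential charts of all
remaining link/seam variables: their Haar density `w_exp` does not depend on the conjugating group element).  THEN the combined window map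
`Θ(z, (y₁, y₂)) = (Θ₁(z, y₁), c(z, y₂))` satisfies the local product chart identity on `X₁ × X₂` with the PRODUCT density:

* `image_tensorWindow_eq` — `Θ(Φ × (B₁ × B₂)) = Θ₁(Φ × B₁) ×ˢ univ`;
* ★★ `restrict_image_tensorWindow_eq_map_withDensity` —
  `(μ₁ ⊗ μ₂)|_{Θ(Φ×(B₁×B₂))} = Θ_*((J₁(z,y₁)·J₂(y₂)) · (κ ⊗ (ρ₁ ⊗ ρ₂))|_{Φ×(B₁×B₂)})`,
  i.e. literally the `hloc` hypothesis of ✓`Literature.MeasureTheory.Group.OrbitTubeMeasure.restrict_tube_eq_map_withDensity(_ofReal)` for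
  the slice `Y₁ × Y₂` (proof: both sides are `(μ₁|_{Θ₁(Φ×B₁)}) ⊗ μ₂`; the right side is checked on rectangles by Tonelli, the full-chart
  identity in `y₂` for fixed `z`, and the anchor identity read as ✓`setLIntegral_window_eq_of_localChart`).
Everything here is PROVED; no definitions, no named facts (namespace `Summit.QuantumFields.YangMills.Theorems.VirialFluxGap.ChartTensor`).
HONEST FRAMING: measure-theoretic plumbing; ⟨24204⟩, ⟨24319⟩ and every rung stay OPEN; the Yang–Mills mass gap (Clay) is NOT touched; no summit
is proved by a line.

## References
* S. Helgason, *Groups and Geometric Analysis* (2000), Ch. I §1 Thm 1.14 (product charts for orbit tubes). [Helgason2000]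
* K. W. Breitung, *Asymptotic Approximations for Probability Integrals*, LNM 1592 (1994), §2.3 Definitions 4–5. [Breitung1994]
-/

set_option autoImplicit false

noncomputable section

open MeasureTheory Set Filter
open scoped ENNReal

namespace Summit.QuantumFields.YangMills.Theorems.VirialFluxGap.ChartTensor

variable {Z Y₁ Y₂ X₁ X₂ : Type*} [MeasurableSpace Z] [MeasurableSpace Y₁] [MeasurableSpace Y₂] [MeasurableSpace X₁]
  [MeasurableSpace X₂] {κ : Measure Z} {ρ₁ : Measure Y₁} {ρ₂ : Measure Y₂} {μ₁ : Measure X₁} {μ₂ : Measure X₂}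
  {Θ₁ : Z × Y₁ → X₁} {c : Z × Y₂ → X₂} {Φ : Set Z} {B₁ : Set Y₁} {B₂ : Set Y₂}

omit [MeasurableSpace Z] [MeasurableSpace Y₁] [MeasurableSpace Y₂] [MeasurableSpace X₁] [MeasurableSpace X₂] in
/-- **The combined window is a product set**: `Θ(Φ × (B₁ × B₂)) = Θ₁(Φ × B₁) ×ˢ univ` when every `c z`, `z ∈ Φ`, maps `B₂` onto `X₂`.
[cite: Helgason2000, Ch. I §1 Thm 1.14] -/
theorem image_tensorWindow_eq (hsurj : ∀ z ∈ Φ, SurjOn (fun y₂ => c (z, y₂)) B₂ univ) :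
    (fun w : Z × (Y₁ × Y₂) => (Θ₁ (w.1, w.2.1), c (w.1, w.2.2))) '' (Φ ×ˢ (B₁ ×ˢ B₂)) = (Θ₁ '' (Φ ×ˢ B₁)) ×ˢ (univ : Set X₂) := by
  ext ⟨x₁, x₂⟩
  constructor
  · rintro ⟨⟨z, y₁, y₂⟩, ⟨hz, hy₁, -⟩, h⟩
    simp only [Prod.mk.injEq] at h
    exact ⟨⟨(z, y₁), ⟨hz, hy₁⟩, h.1⟩, mem_univ _⟩
  · rintro ⟨⟨⟨z, y₁⟩, ⟨hz, hy₁⟩, h1⟩, -⟩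
    obtain ⟨y₂, hy₂, h2⟩ := hsurj z hz (mem_univ x₂)
    exact ⟨(z, y₁, y₂), ⟨hz, hy₁, hy₂⟩, by simp only [h1]; exact Prod.ext rfl h2⟩

/-- ★★ **TENSORING A LOCAL PRODUCT CHART WITH A PARAMETRISED FAMILY OF FULL CHARTS.**  If
`μ₁|_{Θ₁(Φ×B₁)} = Θ₁_*(J₁ · (κ ⊗ ρ₁)|_{Φ×B₁})`, and for every `z ∈ Φ` the map `c z` pushes `J₂ · ρ₂|_{B₂}` to `μ₂` and maps `B₂` onto `X₂`,
then for `Θ(z,(y₁,y₂)) = (Θ₁(z,y₁), c(z,y₂))`: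
`(μ₁ ⊗ μ₂)|_{Θ(Φ×(B₁×B₂))} = Θ_*((J₁(z,y₁) J₂(y₂)) · (κ ⊗ (ρ₁ ⊗ ρ₂))|_{Φ×(B₁×B₂)})`.
[cite: Helgason2000, Ch. I §1 Thm 1.14] [cite: Breitung1994, §2.3 Definitions 4–5] -/
theorem restrict_image_tensorWindow_eq_map_withDensity [SFinite κ] [SFinite ρ₁] [SFinite ρ₂] [SigmaFinite μ₁] [SigmaFinite μ₂]
    (hΘ₁ : Measurable Θ₁) (hc : Measurable c) (hΦ : MeasurableSet Φ) (hB₁ : MeasurableSet B₁) (hB₂ : MeasurableSet B₂)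
    {J₁ : Z × Y₁ → ℝ≥0∞} (hJ₁ : Measurable J₁) {J₂ : Y₂ → ℝ≥0∞} (hJ₂ : Measurable J₂)
    (hloc₁ : μ₁.restrict (Θ₁ '' (Φ ×ˢ B₁)) = (((κ.prod ρ₁).restrict (Φ ×ˢ B₁)).withDensity J₁).map Θ₁)
    (hchart₂ : ∀ z ∈ Φ, ((ρ₂.restrict B₂).withDensity J₂).map (fun y₂ => c (z, y₂)) = μ₂)
    (hsurj : ∀ z ∈ Φ, SurjOn (fun y₂ => c (z, y₂)) B₂ univ) :
    (μ₁.prod μ₂).restrict ((fun w : Z × (Y₁ × Y₂) => (Θ₁ (w.1, w.2.1), c (w.1, w.2.2))) '' (Φ ×ˢ (B₁ ×ˢ B₂))) =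
      (((κ.prod (ρ₁.prod ρ₂)).restrict (Φ ×ˢ (B₁ ×ˢ B₂))).withDensity fun w => J₁ (w.1, w.2.1) * J₂ w.2.2).map
        (fun w : Z × (Y₁ × Y₂) => (Θ₁ (w.1, w.2.1), c (w.1, w.2.2))) := by
  set Θ : Z × (Y₁ × Y₂) → X₁ × X₂ := fun w => (Θ₁ (w.1, w.2.1), c (w.1, w.2.2)) with hΘdef
  have hΘm : Measurable Θ :=
    (hΘ₁.comp (measurable_fst.prodMk (measurable_fst.comp measurable_snd))).prodMk
      (hc.comp (measurable_fst.prodMk (measurable_snd.comp measurable_snd)))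
  have hW : MeasurableSet (Φ ×ˢ (B₁ ×ˢ B₂)) := hΦ.prod (hB₁.prod hB₂)
  have hJm : Measurable fun w : Z × (Y₁ × Y₂) => J₁ (w.1, w.2.1) * J₂ w.2.2 :=
    (hJ₁.comp (measurable_fst.prodMk (measurable_fst.comp measurable_snd))).mul (hJ₂.comp (measurable_snd.comp measurable_snd))
  -- the left side is a product measure
  rw [image_tensorWindow_eq hsurj, ← Measure.prod_restrict (μ := μ₁) (ν := μ₂) (Θ₁ '' (Φ ×ˢ B₁)) univ, Measure.restrict_univ]
  -- check the right side on rectangles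
  refine Measure.prod_eq fun s t hs ht => ?_
  rw [Measure.map_apply hΘm (hs.prod ht), withDensity_apply _ (hΘm (hs.prod ht)), Measure.restrict_restrict (hΘm (hs.prod ht))]
  -- as an iterated integral
  have hind : ∀ w, (Θ ⁻¹' (s ×ˢ t) ∩ Φ ×ˢ (B₁ ×ˢ B₂)).indicator (fun w => J₁ (w.1, w.2.1) * J₂ w.2.2) w =
      ((Φ ×ˢ B₁).indicator (fun p : Z × Y₁ => (Θ₁ ⁻¹' s).indicator (fun p => J₁ p) p) (w.1, w.2.1)) *
        (B₂.indicator (fun y₂ => (t.indicator (fun _ => (1 : ℝ≥0∞)) (c (w.1, y₂))) * J₂ y₂) w.2.2) := by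
    rintro ⟨z, y₁, y₂⟩
    by_cases hz : z ∈ Φ <;> by_cases hy₁ : y₁ ∈ B₁ <;> by_cases hy₂ : y₂ ∈ B₂ <;> by_cases h1 : Θ₁ (z, y₁) ∈ s <;>
      by_cases h2 : c (z, y₂) ∈ t <;>
      simp [Set.indicator, hz, hy₁, hy₂, h1, h2, hΘdef, Set.mem_prod, Set.mem_preimage, Set.mem_inter_iff]
  rw [← lintegral_indicator ((hΘm (hs.prod ht)).inter hW)]
  simp_rw [hind]
  -- Tonelli: integrate `y₂` first for fixed `(z, y₁)`
  have hF₁ : Measurable fun p : Z × Y₁ => (Φ ×ˢ B₁).indicator (fun p : Z × Y₁ => (Θ₁ ⁻¹' s).indicator (fun p => J₁ p) p) p :=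
    ((hJ₁.indicator (hΘ₁ hs)).indicator (hΦ.prod hB₁))
  have hF₂ : Measurable fun q : Z × Y₂ => B₂.indicator (fun y₂ => (t.indicator (fun _ => (1 : ℝ≥0∞)) (c (q.1, y₂))) * J₂ y₂) q.2 := by
    have h1 : Measurable fun q : Z × Y₂ => t.indicator (fun _ => (1 : ℝ≥0∞)) (c q) * J₂ q.2 :=
      ((measurable_const.indicator ht).comp hc).mul (hJ₂.comp measurable_snd)
    have : (fun q : Z × Y₂ => B₂.indicator (fun y₂ => (t.indicator (fun _ => (1 : ℝ≥0∞)) (c (q.1, y₂))) * J₂ y₂) q.2) =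
        (univ ×ˢ B₂).indicator (fun q : Z × Y₂ => t.indicator (fun _ => (1 : ℝ≥0∞)) (c q) * J₂ q.2) := by
      funext q
      by_cases hq : q.2 ∈ B₂
      · simp [Set.indicator_of_mem hq, Set.indicator_of_mem (show q ∈ univ ×ˢ B₂ from ⟨mem_univ _, hq⟩)]
      · rw [Set.indicator_of_notMem hq, Set.indicator_of_notMem (show q ∉ univ ×ˢ B₂ from fun h => hq h.2)]
    rw [this]
    exact h1.indicator (MeasurableSet.univ.prod hB₂)
  have hinner : ∀ z ∈ Φ, ∫⁻ y₂, B₂.indicator (fun y₂ => (t.indicator (fun _ => (1 : ℝ≥0∞)) (c (z, y₂))) * J₂ y₂) y₂ ∂ρ₂ = μ₂ t := by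
    intro z hz
    have hcz : Measurable (fun y₂ : Y₂ => c (z, y₂)) := hc.comp (measurable_const.prodMk measurable_id)
    rw [← hchart₂ z hz, Measure.map_apply hcz ht, withDensity_apply _ (hcz ht), Measure.restrict_restrict (hcz ht),
      ← lintegral_indicator ((hcz ht).inter hB₂)]
    refine lintegral_congr fun y₂ => ?_
    by_cases hy₂ : y₂ ∈ B₂ <;> by_cases h2 : c (z, y₂) ∈ t <;>
      simp [Set.indicator, hy₂, h2, Set.mem_inter_iff, Set.mem_preimage, mul_comm]
  calc ∫⁻ w, ((Φ ×ˢ B₁).indicator (fun p : Z × Y₁ => (Θ₁ ⁻¹' s).indicator (fun p => J₁ p) p) (w.1, w.2.1)) *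
          (B₂.indicator (fun y₂ => (t.indicator (fun _ => (1 : ℝ≥0∞)) (c (w.1, y₂))) * J₂ y₂) w.2.2) ∂κ.prod (ρ₁.prod ρ₂)
      = ∫⁻ z, ∫⁻ y, ((Φ ×ˢ B₁).indicator (fun p : Z × Y₁ => (Θ₁ ⁻¹' s).indicator (fun p => J₁ p) p) (z, y.1)) *
          (B₂.indicator (fun y₂ => (t.indicator (fun _ => (1 : ℝ≥0∞)) (c (z, y₂))) * J₂ y₂) y.2) ∂ρ₁.prod ρ₂ ∂κ := by
        rw [lintegral_prod _ ?_]
        exact ((hF₁.comp (measurable_fst.prodMk (measurable_fst.comp measurable_snd))).mul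
          (hF₂.comp (measurable_fst.prodMk (measurable_snd.comp measurable_snd)))).aemeasurable
    _ = ∫⁻ z, (∫⁻ y₁, (Φ ×ˢ B₁).indicator (fun p : Z × Y₁ => (Θ₁ ⁻¹' s).indicator (fun p => J₁ p) p) (z, y₁) ∂ρ₁) *
          (∫⁻ y₂, B₂.indicator (fun y₂ => (t.indicator (fun _ => (1 : ℝ≥0∞)) (c (z, y₂))) * J₂ y₂) y₂ ∂ρ₂) ∂κ := by
        refine lintegral_congr fun z => ?_
        exact lintegral_prod_mul (μ := ρ₁) (ν := ρ₂)
          (f := fun y₁ => (Φ ×ˢ B₁).indicator (fun p : Z × Y₁ => (Θ₁ ⁻¹' s).indicator (fun p => J₁ p) p) (z, y₁))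
          (g := fun y₂ => B₂.indicator (fun y₂ => (t.indicator (fun _ => (1 : ℝ≥0∞)) (c (z, y₂))) * J₂ y₂) y₂)
          (hF₁.comp (measurable_const.prodMk measurable_id)).aemeasurable
          (hF₂.comp (measurable_const.prodMk measurable_id)).aemeasurable
    _ = ∫⁻ z, (∫⁻ y₁, (Φ ×ˢ B₁).indicator (fun p : Z × Y₁ => (Θ₁ ⁻¹' s).indicator (fun p => J₁ p) p) (z, y₁) ∂ρ₁) * μ₂ t ∂κ := by
        refine lintegral_congr fun z => ?_
        by_cases hz : z ∈ Φ
        · rw [hinner z hz]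
        · have h0 : ∀ y₁, (Φ ×ˢ B₁).indicator (fun p : Z × Y₁ => (Θ₁ ⁻¹' s).indicator (fun p => J₁ p) p) (z, y₁) = 0 :=
            fun y₁ => Set.indicator_of_notMem (fun h => hz h.1) _
          simp [h0]
    _ = (∫⁻ p in Φ ×ˢ B₁, (Θ₁ ⁻¹' s).indicator (fun p => J₁ p) p ∂κ.prod ρ₁) * μ₂ t := by
        rw [lintegral_mul_const _ (hF₁.lintegral_prod_right'), ← lintegral_indicator (hΦ.prod hB₁), lintegral_prod _ hF₁.aemeasurable]
    _ = μ₁.restrict (Θ₁ '' (Φ ×ˢ B₁)) s * μ₂ t := by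
        congr 1
        rw [hloc₁, Measure.map_apply hΘ₁ hs, withDensity_apply _ (hΘ₁ hs), Measure.restrict_restrict (hΘ₁ hs),
          ← lintegral_indicator ((hΘ₁ hs).inter (hΦ.prod hB₁)), ← lintegral_indicator (hΦ.prod hB₁)]
        refine lintegral_congr fun p => ?_
        by_cases hp : p ∈ Φ ×ˢ B₁ <;> by_cases h1 : p ∈ Θ₁ ⁻¹' s <;> simp [Set.indicator, hp, h1]

end Summit.QuantumFields.YangMills.Theorems.VirialFluxGap.ChartTensor

end
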